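import Mathlib
import Summits.MatrixMultiplication.MatrixMultiplication.Theses.WindowedCompletionRank

/-!
# MatrixMultiplication / WindowedCompletionRank — support `WeylPresentation`
(stmt-MatrixMultiplication-5498)

The clock-and-shift (Weyl, generalised Pauli) presentation of the matrix algebra: on
`ℂ^{ℤ_m^k}` put `W_{(b,β)} e_c = ζ_m^{β·c} e_{c+b}`, i.e. the matrix entries
`W_g(p, q) = [p = q + g.1] · χ(g.2 ⬝ᵥ q)` with `χ = ZMod.stdAddChar` (`χ(j) = exp(2πi j/m)`).
Then

* `W_g W_h = χ(g.2 ⬝ᵥ h.1) · W_{g+h}` (`weyl_mul_apply`), so `g ↦ W_g` is a projective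
  representation of `G = (ℤ_m^k)²` with cocycle `ζ_m^{g₂·h₁}` and `M_{m^k}(ℂ) ≅ ℂ^ε[G]`;
* the `W_g` are orthogonal for the trace form:
  `∑_g W⁻_g(p', q') W_g(p, q) = m^k · [p = p' ∧ q = q']` with `W⁻_g(p,q) = [p = q + g.1] χ(−g.2 ⬝ᵥ q)`
  (`weyl_orth_apply`, from the character sum `∑_u χ(u ⬝ᵥ v) = m^k [v = 0]`, `weyl_charSum`).

Consequently the structure tensor of `M_{m^k}` in matrix units, `⟨m^k, m^k, m^k⟩`, is obtained
from the structure tensor in the Weyl basis — the pulled-back twisted addition table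
`[e b + e c = e a] · S(e a, e b, e c)` for ANY completion `S` of the cocycle and any bijection
`e : [m^k]² ≃ G` — by the change of basis `A a' a = W_{e a}(f a')`,
`B b' b = C b' b = m^{-k} W⁻_{e b}(f b')` (`f : [m^k] ≃ ℤ_m^k` any bijection): a restriction in the
sense of `TensorRestrictsTo` (`weyl_restrictsTo_matMulTensor`). The main theorem
`weylPresentation_proof` has exactly the type of the route decl
`…Theses.WindowedCompletionRank.WeylPresentation`.

References: J. M. Landsberg, *Geometry and Complexity Theory* (2017), §4 (structure tensors of
algebras, `M_n ≅` twisted group algebra); Yu. A. Bahturin, S. K. Sehgal, M. V. Zaicev, *Group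
gradings on associative algebras*, J. Algebra 241 (2001) (Pauli / ε-gradings of `M_n`).
-/

-- `Summit.<Summit>.<Problem>` is the tree's mandated summit-side namespace; for this
-- single-conjunct summit the two coincide, so the file silences `dupNamespace`.
set_option linter.dupNamespace false

noncomputable section

namespace Summit.MatrixMultiplication.MatrixMultiplication.Theorems

open scoped BigOperators
open Literature.Computability.AlgebraicComplexity

section Weyl

variable {m k : ℕ} [NeZero m]

/-- Character sum over `ℤ_m^k`: `∑_u χ(u ⬝ᵥ v) = m^k` if `v = 0` and `0` otherwise
(`χ = ZMod.stdAddChar` is primitive, so `u ↦ χ(u ⬝ᵥ v)` is a non-trivial character of `ℤ_m^k`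
when `v ≠ 0`). [folklore] -/
theorem weyl_charSum (v : Fin k → ZMod m) :
    ∑ u : Fin k → ZMod m, (ZMod.stdAddChar (N := m)) (u ⬝ᵥ v) =
      if v = 0 then ((m : ℂ) ^ k) else 0 := by
  by_cases hv : v = 0
  · subst hv
    have hcard : Fintype.card (Fin k → ZMod m) = m ^ k := by simp [ZMod.card]
    simp only [dotProduct_zero, AddChar.map_zero_eq_one, Finset.sum_const, Finset.card_univ,
      hcard, nsmul_eq_mul, mul_one, if_true, Nat.cast_pow]
  · rw [if_neg hv]
    obtain ⟨i, hi⟩ := Function.ne_iff.1 hv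
    have hi : v i ≠ 0 := hi
    -- the character `u ↦ χ (u ⬝ᵥ v)` of `ℤ_m^k`
    let ψ : AddChar (Fin k → ZMod m) ℂ :=
      { toFun := fun u => (ZMod.stdAddChar (N := m)) (u ⬝ᵥ v)
        map_zero_eq_one' := by simp
        map_add_eq_mul' := fun a b => by
          simp only [add_dotProduct, AddChar.map_add_eq_mul] }
    have hψ : ψ ≠ 1 := by
      intro h
      apply ZMod.isPrimitive_stdAddChar m hi
      ext x
      have hx := congrArg (fun φ : AddChar (Fin k → ZMod m) ℂ => φ (Pi.single i x)) h
      simp only [ψ, AddChar.coe_mk, AddChar.one_apply, single_dotProduct] at hx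
      rw [AddChar.mulShift_apply, AddChar.one_apply, mul_comm]
      exact hx
    exact AddChar.sum_eq_zero_of_ne_one hψ

/-- **Weyl multiplication rule** `W_g W_h = χ(g.2 ⬝ᵥ h.1) W_{g+h}` for the clock-and-shift
matrices `W_g(p,q) = [p = q + g.1] χ(g.2 ⬝ᵥ q)`, entrywise. [folklore] -/
theorem weyl_mul_apply
    (W : (Fin k → ZMod m) × (Fin k → ZMod m) → (Fin k → ZMod m) → (Fin k → ZMod m) → ℂ)
    (hW : ∀ g p q, W g p q =
      if p = q + g.1 then (ZMod.stdAddChar (N := m)) (g.2 ⬝ᵥ q) else 0)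
    (g h : (Fin k → ZMod m) × (Fin k → ZMod m)) (p r : Fin k → ZMod m) :
    ∑ q, W g p q * W h q r = (ZMod.stdAddChar (N := m)) (g.2 ⬝ᵥ h.1) * W (g + h) p r := by
  rw [Fintype.sum_eq_single (r + h.1)]
  · simp only [hW, if_true]
    by_cases hp : p = r + h.1 + g.1
    · have hp' : p = r + (g + h).1 := by rw [hp, Prod.fst_add, add_assoc, add_comm h.1]
      rw [if_pos hp, if_pos hp', Prod.snd_add, dotProduct_add, add_dotProduct,
        AddChar.map_add_eq_mul, AddChar.map_add_eq_mul]
      ring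
    · have hp' : ¬ p = r + (g + h).1 := by
        rw [Prod.fst_add, add_comm g.1, ← add_assoc]
        exact hp
      rw [if_neg hp, if_neg hp', zero_mul, mul_zero]
  · intro q hq
    rw [hW h, if_neg hq, mul_zero]

/-- **Orthogonality of the Weyl matrices** for the trace form:
`∑_g W⁻_g(p',q') · W_g(p,q) = m^k · [p = p' ∧ q = q']`, where
`W⁻_g(p,q) = [p = q + g.1] χ(−g.2 ⬝ᵥ q)` is the entrywise inverse phase. [folklore] -/
theorem weyl_orth_apply
    (W W' :
      (Fin k → ZMod m) × (Fin k → ZMod m) → (Fin k → ZMod m) → (Fin k → ZMod m) → ℂ)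
    (hW : ∀ g p q, W g p q =
      if p = q + g.1 then (ZMod.stdAddChar (N := m)) (g.2 ⬝ᵥ q) else 0)
    (hW' : ∀ g p q, W' g p q =
      if p = q + g.1 then (ZMod.stdAddChar (N := m)) (-(g.2 ⬝ᵥ q)) else 0)
    (p q p' q' : Fin k → ZMod m) :
    ∑ g : (Fin k → ZMod m) × (Fin k → ZMod m), W' g p' q' * W g p q =
      if p = p' ∧ q = q' then ((m : ℂ) ^ k) else 0 := by
  rw [Fintype.sum_prod_type, Fintype.sum_eq_single (p - q)]
  · have hpq : q + (p - q) = p := add_sub_cancel q p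
    simp only [hW, hW', hpq, if_true]
    by_cases h' : p' = q' + (p - q)
    · simp only [if_pos h']
      have hx : ∀ x : Fin k → ZMod m,
          (ZMod.stdAddChar (N := m)) (-(x ⬝ᵥ q')) * (ZMod.stdAddChar (N := m)) (x ⬝ᵥ q) =
            (ZMod.stdAddChar (N := m)) (x ⬝ᵥ (q - q')) := by
        intro x
        rw [← AddChar.map_add_eq_mul, dotProduct_sub, neg_add_eq_sub]
      simp_rw [hx]
      rw [weyl_charSum]
      by_cases hq : q = q'
      · subst hq
        rw [hpq] at h'
        simp [h']
      · rw [if_neg (fun h => hq (sub_eq_zero.1 h)), if_neg (fun h => hq h.2)]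
    · simp only [if_neg h', zero_mul, Finset.sum_const_zero]
      rw [if_neg]
      rintro ⟨rfl, rfl⟩
      exact h' hpq.symm
  · intro b hb
    refine Finset.sum_eq_zero fun y _ => ?_
    rw [hW, if_neg, mul_zero]
    intro h
    exact hb (by rw [h, add_sub_cancel_left])

/-- **Change of basis from matrix units to the Weyl basis is a restriction.** For every
completion `S` of the cocycle (`S (g+h) g h = χ(g.2 ⬝ᵥ h.1)`), every bijection
`e : [m^k]² ≃ (ℤ_m^k)²` and every bijection `f : [m^k] ≃ ℤ_m^k`, the matrix multiplication
tensor `⟨m^k,m^k,m^k⟩` is the restriction of `[e b + e c = e a] · S(e a, e b, e c)` along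
`A a' a = W_{e a}(f a')`, `B b' b = C b' b = m^{-k} W⁻_{e b}(f b')`. [folklore] -/
theorem weyl_restrictsTo_matMulTensor
    (S : (Fin k → ZMod m) × (Fin k → ZMod m) → (Fin k → ZMod m) × (Fin k → ZMod m) →
      (Fin k → ZMod m) × (Fin k → ZMod m) → ℂ)
    (hS : ∀ g h : (Fin k → ZMod m) × (Fin k → ZMod m),
      S (g + h) g h = (ZMod.stdAddChar (N := m)) (g.2 ⬝ᵥ h.1))
    (e : Fin (m ^ k) × Fin (m ^ k) ≃ (Fin k → ZMod m) × (Fin k → ZMod m))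
    (f : Fin (m ^ k) ≃ (Fin k → ZMod m)) :
    TensorRestrictsTo
      (fun a b c : Fin (m ^ k) × Fin (m ^ k) => if e b + e c = e a then S (e a) (e b) (e c) else 0)
      (matMulTensor ℂ (m ^ k) (m ^ k) (m ^ k)) := by
  -- the Weyl entries and their inverse phases
  set W :
      (Fin k → ZMod m) × (Fin k → ZMod m) → (Fin k → ZMod m) → (Fin k → ZMod m) → ℂ :=
    fun g p q => if p = q + g.1 then (ZMod.stdAddChar (N := m)) (g.2 ⬝ᵥ q) else 0 with hWdef
  set W' :
      (Fin k → ZMod m) × (Fin k → ZMod m) → (Fin k → ZMod m) → (Fin k → ZMod m) → ℂ :=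
    fun g p q => if p = q + g.1 then (ZMod.stdAddChar (N := m)) (-(g.2 ⬝ᵥ q)) else 0
    with hW'def
  have hW : ∀ g p q, W g p q =
      if p = q + g.1 then (ZMod.stdAddChar (N := m)) (g.2 ⬝ᵥ q) else 0 := fun _ _ _ => rfl
  have hW' : ∀ g p q, W' g p q =
      if p = q + g.1 then (ZMod.stdAddChar (N := m)) (-(g.2 ⬝ᵥ q)) else 0 := fun _ _ _ => rfl
  have hmk : ((m : ℂ) ^ k) ≠ 0 := pow_ne_zero _ (Nat.cast_ne_zero.2 (NeZero.ne m))
  -- orthogonality, indexed by `[m^k]` through `f` and by `[m^k]²` through `e`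
  have horth : ∀ x' y' x y : Fin (m ^ k),
      ∑ b : Fin (m ^ k) × Fin (m ^ k),
        ((m : ℂ) ^ k)⁻¹ * W' (e b) (f x') (f y') * W (e b) (f x) (f y) =
        if x = x' ∧ y = y' then 1 else 0 := by
    intro x' y' x y
    have h1 : ∑ b : Fin (m ^ k) × Fin (m ^ k),
        ((m : ℂ) ^ k)⁻¹ * W' (e b) (f x') (f y') * W (e b) (f x) (f y) =
        ((m : ℂ) ^ k)⁻¹ * ∑ g : (Fin k → ZMod m) × (Fin k → ZMod m),
          W' g (f x') (f y') * W g (f x) (f y) := by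
      rw [Finset.mul_sum,
        ← e.sum_comp (fun g => ((m : ℂ) ^ k)⁻¹ * (W' g (f x') (f y') * W g (f x) (f y)))]
      exact Finset.sum_congr rfl fun b _ => by ring
    rw [h1, weyl_orth_apply W W' hW hW']
    by_cases hxy : x = x' ∧ y = y'
    · rw [if_pos hxy, if_pos ⟨congrArg f hxy.1, congrArg f hxy.2⟩, inv_mul_cancel₀ hmk]
    · rw [if_neg hxy, if_neg (fun h => hxy ⟨f.injective h.1, f.injective h.2⟩), mul_zero]
  refine ⟨fun a' a => W (e a) (f a'.1) (f a'.2),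
    fun b' b => ((m : ℂ) ^ k)⁻¹ * W' (e b) (f b'.1) (f b'.2),
    fun c' c => ((m : ℂ) ^ k)⁻¹ * W' (e c) (f c'.1) (f c'.2), fun a' b' c' => ?_⟩
  dsimp only
  -- the inner sum over `a`: one term, then the Weyl multiplication rule
  have key : ∀ b c : Fin (m ^ k) × Fin (m ^ k),
      ∑ a : Fin (m ^ k) × Fin (m ^ k), W (e a) (f a'.1) (f a'.2) *
        (((m : ℂ) ^ k)⁻¹ * W' (e b) (f b'.1) (f b'.2)) *
        (((m : ℂ) ^ k)⁻¹ * W' (e c) (f c'.1) (f c'.2)) *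
        (if e b + e c = e a then S (e a) (e b) (e c) else 0) =
      ∑ y : Fin (m ^ k), (((m : ℂ) ^ k)⁻¹ * W' (e b) (f b'.1) (f b'.2) * W (e b) (f a'.1) (f y)) *
        (((m : ℂ) ^ k)⁻¹ * W' (e c) (f c'.1) (f c'.2) * W (e c) (f y) (f a'.2)) := by
    intro b c
    rw [Fintype.sum_eq_single (e.symm (e b + e c))]
    · rw [Equiv.apply_symm_apply, if_pos rfl, hS]
      have hmul : ∑ y : Fin (m ^ k), W (e b) (f a'.1) (f y) * W (e c) (f y) (f a'.2) =
          (ZMod.stdAddChar (N := m)) ((e b).2 ⬝ᵥ (e c).1) * W (e b + e c) (f a'.1) (f a'.2) := by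
        rw [f.sum_comp (fun q => W (e b) (f a'.1) q * W (e c) q (f a'.2))]
        exact weyl_mul_apply W hW (e b) (e c) (f a'.1) (f a'.2)
      have hR : ∑ y : Fin (m ^ k),
          (((m : ℂ) ^ k)⁻¹ * W' (e b) (f b'.1) (f b'.2) * W (e b) (f a'.1) (f y)) *
          (((m : ℂ) ^ k)⁻¹ * W' (e c) (f c'.1) (f c'.2) * W (e c) (f y) (f a'.2)) =
          (((m : ℂ) ^ k)⁻¹ * W' (e b) (f b'.1) (f b'.2)) *
            (((m : ℂ) ^ k)⁻¹ * W' (e c) (f c'.1) (f c'.2)) *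
            ∑ y : Fin (m ^ k), W (e b) (f a'.1) (f y) * W (e c) (f y) (f a'.2) := by
        rw [Finset.mul_sum]
        exact Finset.sum_congr rfl fun y _ => by ring
      rw [hR, hmul]
      ring
    · intro a ha
      rw [if_neg, mul_zero]
      intro hEq
      exact ha ((Equiv.eq_symm_apply e).2 hEq.symm)
  rw [sum_rev₃]
  simp_rw [key]
  rw [sum_rev₃]
  have hfac : ∀ y : Fin (m ^ k),
      ∑ b : Fin (m ^ k) × Fin (m ^ k), ∑ c : Fin (m ^ k) × Fin (m ^ k),
        (((m : ℂ) ^ k)⁻¹ * W' (e b) (f b'.1) (f b'.2) * W (e b) (f a'.1) (f y)) *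
        (((m : ℂ) ^ k)⁻¹ * W' (e c) (f c'.1) (f c'.2) * W (e c) (f y) (f a'.2)) =
      (∑ b : Fin (m ^ k) × Fin (m ^ k),
        ((m : ℂ) ^ k)⁻¹ * W' (e b) (f b'.1) (f b'.2) * W (e b) (f a'.1) (f y)) *
      (∑ c : Fin (m ^ k) × Fin (m ^ k),
        ((m : ℂ) ^ k)⁻¹ * W' (e c) (f c'.1) (f c'.2) * W (e c) (f y) (f a'.2)) := by
    intro y
    rw [Finset.sum_mul_sum]
  simp_rw [hfac, horth]
  -- bookkeeping of Kronecker deltas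
  rw [Fintype.sum_eq_single b'.2]
  · simp only [matMulTensor, and_true]
    by_cases h1 : a'.1 = b'.1 <;> by_cases h2 : b'.2 = c'.1 <;> by_cases h3 : a'.2 = c'.2 <;>
      simp [h1, h2, h3]
  · intro y hy
    rw [if_neg (fun h => hy h.2), zero_mul]

end Weyl

/-- **Support `WeylPresentation` of route WindowedCompletionRank** (stmt-MatrixMultiplication-5498),
exact route decl: for all `m ≥ 1`, `k`, every completion `S` of the Weyl cocycle
`S (g+h) g h = ζ_m^{g₂·h₁}` on `((ℤ_m^k)²)³` and every bijection `e : [m^k]² ≃ (ℤ_m^k)²`, the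
matrix multiplication tensor `⟨m^k,m^k,m^k⟩` is a restriction of the pulled-back twisted table
`[e b + e c = e a] · S(e a, e b, e c)` (clock-and-shift presentation `M_{m^k} ≅ ℂ^ε[(ℤ_m^k)²]`).
[folklore] -/
theorem weylPresentation_proof :
    Summit.MatrixMultiplication.MatrixMultiplication.Theses.WindowedCompletionRank.WeylPresentation := by
  intro m k hm S hS e
  haveI : NeZero m := ⟨by omega⟩
  have hcard : Fintype.card (Fin k → ZMod m) = m ^ k := by simp [ZMod.card]
  have hS' : ∀ g h : (Fin k → ZMod m) × (Fin k → ZMod m),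
      S (g + h) g h = (ZMod.stdAddChar (N := m)) (g.2 ⬝ᵥ h.1) := by
    intro g h
    rw [hS, ZMod.stdAddChar_apply, ZMod.toCircle_apply]
    rfl
  exact weyl_restrictsTo_matMulTensor S hS' e (Fintype.equivFinOfCardEq hcard).symm

end Summit.MatrixMultiplication.MatrixMultiplication.Theorems
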